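import Mathlib
import Literature.Analysis.FluidPDE.SelfSimilar

/-!
# ZoomReturnDoorDssExtension — S25 «ZoomReturnDoor», part 5/6 (prover material for K-open/K-band, ROUND-24 §3 step G4, algebraic core): THE DSS EXTENSION OF A PAST FIELD

The compactness limits of the K-open / K-band plans are known only on a past half-line `t ≤ t₀ < 0` and are symmetric
there under ONE factor `c > 1`: `v(t,x) = c · v(c²t, cx)` for `t ≤ t₀`.  This file constructs the extension `dssExtend c t₀ v`
to all times and PROVES: it agrees with `v` on `t ≤ t₀` (`dssExtend_eq_self`), on every half-line `{t ≤ t₀ c^{−2m}}` it is the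
`m`-fold Navier–Stokes rescaling of `v` (`dssExtend_eq`, so window-wise regularity / weak-solution properties transfer by
scaling covariance), it is EXACTLY `c`-DSS in the tree's sense `IsDiscretelySelfSimilar c` (`isDiscretelySelfSimilar_dssExtend`),
and it inherits the Type-I decay constant (`hasTypeIDecay_dssExtend`, scale invariance of `D/(‖x‖+√−t)`).  Pure algebra; no PDE.
nsreg-p1 g20 (ADDENDUM-24A; design file `r24/Sketch25ext.lean`); THEOREMS-ONLY, no route, no items.
-/

noncomputable section

set_option linter.dupNamespace false
set_option linter.unusedVariables false

namespace Summit.NavierStokesRegularity.NavierStokesRegularity.Theorems.ZoomReturnDoorDssExtension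

open Literature.Analysis.FluidPDE

variable {E F : Type*} [NormedAddCommGroup E] [NormedSpace ℝ E] [NormedAddCommGroup F] [NormedSpace ℝ F]

/-- For `t < 0`, `t₀ < 0`, `1 < c` some power `c^{2k}` pushes `t` below `t₀`. -/
theorem exists_pow_mul_le {c t t₀ : ℝ} (hc : 1 < c) (ht : t < 0) (ht₀ : t₀ < 0) :
    ∃ k : ℕ, c ^ (2 * k) * t ≤ t₀ := by
  have hc2 : 1 < c ^ 2 := by nlinarith
  obtain ⟨k, hk⟩ := pow_unbounded_of_one_lt (t₀ / t) hc2
  refine ⟨k, ?_⟩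
  have hk' : t₀ / t < c ^ (2 * k) := by rw [pow_mul]; exact hk
  exact ((div_lt_iff_of_neg ht).1 hk').le

open Classical in
/-- **The DSS extension.**  For `t < 0` (and admissible parameters) take the LEAST `k` with `c^{2k} t ≤ t₀` and put
`ṽ(t,x) = c^k · v(c^{2k} t, c^k x)`; for `t ≥ 0` (or inadmissible parameters) put `0`. -/
def dssExtend (c t₀ : ℝ) (v : ℝ → E → F) : ℝ → E → F := fun t x =>
  if h : t < 0 ∧ t₀ < 0 ∧ 1 < c then
    (c ^ Nat.find (exists_pow_mul_le h.2.2 h.1 h.2.1)) •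
      v (c ^ (2 * Nat.find (exists_pow_mul_le h.2.2 h.1 h.2.1)) * t)
        ((c ^ Nat.find (exists_pow_mul_le h.2.2 h.1 h.2.1)) • x)
  else 0

/-- `dssExtend c t₀ v` vanishes at times `t ≥ 0`. -/
theorem dssExtend_of_nonneg {c t₀ : ℝ} (v : ℝ → E → F) {t : ℝ} (ht : 0 ≤ t) (x : E) :
    dssExtend c t₀ v t x = 0 := by
  unfold dssExtend
  rw [dif_neg]
  exact fun h => absurd h.1 (not_lt.2 ht)

section Symmetric

variable {c t₀ : ℝ} {v : ℝ → E → F}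

/-- Iterating the one-factor symmetry: on `t ≤ t₀`, `c^k · v(c^{2k} t, c^k x)` does not depend on `k`. -/
theorem iterate_eq (hc : 1 < c) (ht₀ : t₀ < 0) (hsym : ∀ t ≤ t₀, ∀ x, v t x = c • v (c ^ 2 * t) (c • x))
    {t : ℝ} (ht : t ≤ t₀) (x : E) (k : ℕ) :
    (c ^ k) • v (c ^ (2 * k) * t) ((c ^ k) • x) = v t x := by
  induction k with
  | zero => simp
  | succ k ih =>
    -- `s := c^{2k} t ≤ t₀`, apply the symmetry at `s`
    have hc0 : 0 < c := zero_lt_one.trans hc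
    have ht0 : t < 0 := lt_of_le_of_lt ht ht₀
    have hs : c ^ (2 * k) * t ≤ t₀ := by
      have _h := ht0
      have h1 : 1 ≤ c ^ (2 * k) := one_le_pow₀ hc.le
      nlinarith
    have key := hsym (c ^ (2 * k) * t) hs ((c ^ k) • x)
    -- rewrite the successor expression into `c^k • (c • v (c² s) (c • c^k x))`
    have e1 : c ^ (2 * (k + 1)) * t = c ^ 2 * (c ^ (2 * k) * t) := by ring
    have e2 : (c ^ (k + 1)) • x = c • ((c ^ k) • x) := by rw [pow_succ, mul_comm, mul_smul]
    rw [e1, e2, pow_succ, mul_smul, ← key, ih]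

/-- **Representation on half-lines.**  If `c^{2m} t ≤ t₀` then `ṽ(t,x) = c^m · v(c^{2m} t, c^m x)` — in particular
`ṽ` is, on the half-line `{t ≤ t₀ c^{−2m}}`, the `m`-fold Navier–Stokes rescaling of `v`. -/
theorem dssExtend_eq (hc : 1 < c) (ht₀ : t₀ < 0) (hsym : ∀ t ≤ t₀, ∀ x, v t x = c • v (c ^ 2 * t) (c • x))
    {t : ℝ} {m : ℕ} (hm : c ^ (2 * m) * t ≤ t₀) (x : E) :
    dssExtend c t₀ v t x = (c ^ m) • v (c ^ (2 * m) * t) ((c ^ m) • x) := by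
  classical
  have hc0 : 0 < c := zero_lt_one.trans hc
  have ht : t < 0 := by
    by_contra h
    push Not at h
    have : 0 ≤ c ^ (2 * m) * t := mul_nonneg (pow_nonneg hc0.le _) h
    linarith
  have hadm : t < 0 ∧ t₀ < 0 ∧ 1 < c := ⟨ht, ht₀, hc⟩
  unfold dssExtend
  rw [dif_pos hadm]
  set k := Nat.find (exists_pow_mul_le hadm.2.2 hadm.1 hadm.2.1) with hk_def
  have hk : c ^ (2 * k) * t ≤ t₀ := Nat.find_spec (exists_pow_mul_le hadm.2.2 hadm.1 hadm.2.1)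
  have hkm : k ≤ m := Nat.find_min' _ hm
  -- both sides equal `v` transported from the time `c^{2k} t ≤ t₀`, iterated `m - k` more times
  obtain ⟨j, rfl⟩ := Nat.exists_eq_add_of_le hkm
  have hiter := iterate_eq hc ht₀ hsym hk ((c ^ k) • x) j
  -- `c^j • v (c^{2j} (c^{2k} t)) (c^j • c^k • x) = v (c^{2k} t) (c^k • x)`
  have e1 : c ^ (2 * (k + j)) * t = c ^ (2 * j) * (c ^ (2 * k) * t) := by ring
  have e2 : (c ^ (k + j)) • x = (c ^ j) • ((c ^ k) • x) := by rw [pow_add, mul_comm, mul_smul]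
  rw [e1, e2, pow_add, mul_smul, hiter]

/-- `ṽ = v` on the past half-line `t ≤ t₀`. -/
theorem dssExtend_eq_self (hc : 1 < c) (ht₀ : t₀ < 0) (hsym : ∀ t ≤ t₀, ∀ x, v t x = c • v (c ^ 2 * t) (c • x))
    {t : ℝ} (ht : t ≤ t₀) (x : E) : dssExtend c t₀ v t x = v t x := by
  have h := dssExtend_eq hc ht₀ hsym (m := 0) (t := t) (by simpa using ht) x
  simpa using h

/-- **The extension is exactly `c`-DSS** (`nsRescale c ṽ = ṽ`, all times). -/
theorem isDiscretelySelfSimilar_dssExtend (hc : 1 < c) (ht₀ : t₀ < 0)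
    (hsym : ∀ t ≤ t₀, ∀ x, v t x = c • v (c ^ 2 * t) (c • x)) :
    IsDiscretelySelfSimilar c (dssExtend c t₀ v) := by
  classical
  have hc0 : 0 < c := zero_lt_one.trans hc
  funext t x
  rw [nsRescale_apply]
  rcases lt_or_ge t 0 with ht | ht
  · -- choose `m` large for BOTH `t` and `c² t`
    have hct : c ^ 2 * t < 0 := mul_neg_of_pos_of_neg (by positivity) ht
    obtain ⟨k, hk⟩ := exists_pow_mul_le hc ht ht₀
    obtain ⟨k', hk'⟩ := exists_pow_mul_le hc hct ht₀
    -- m := k + k' works for `c² t` (larger powers push further down since values are negative)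
    have hmono : ∀ {s : ℝ} {a b : ℕ}, s < 0 → a ≤ b → c ^ (2 * a) * s ≤ t₀ → c ^ (2 * b) * s ≤ t₀ := by
      intro s a b hs hab h
      obtain ⟨j, rfl⟩ := Nat.exists_eq_add_of_le hab
      have h1 : 1 ≤ c ^ (2 * j) := one_le_pow₀ hc.le
      have hneg : c ^ (2 * a) * s ≤ 0 := by
        have := mul_nonpos_iff.2 (Or.inl ⟨pow_nonneg hc0.le (2 * a), hs.le⟩)
        simpa using this
      calc c ^ (2 * (a + j)) * s = c ^ (2 * j) * (c ^ (2 * a) * s) := by ring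
        _ ≤ 1 * (c ^ (2 * a) * s) := by nlinarith
        _ ≤ t₀ := by simpa using h
    have hm' : c ^ (2 * (k + k')) * (c ^ 2 * t) ≤ t₀ := hmono hct (Nat.le_add_left k' k) hk'
    have hm : c ^ (2 * (k + k' + 1)) * t ≤ t₀ := by
      have : c ^ (2 * (k + k' + 1)) * t = c ^ (2 * (k + k')) * (c ^ 2 * t) := by ring
      rw [this]; exact hm'
    rw [dssExtend_eq hc ht₀ hsym hm' (c • x), dssExtend_eq hc ht₀ hsym hm x]
    have e1 : c ^ (2 * (k + k')) * (c ^ 2 * t) = c ^ (2 * (k + k' + 1)) * t := by ring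
    have e2 : (c ^ (k + k')) • (c • x) = (c ^ (k + k' + 1)) • x := by
      rw [← mul_smul, ← pow_succ]
    rw [e1, e2, ← mul_smul, ← pow_succ']
  · -- `t ≥ 0`: both sides vanish
    have hct : 0 ≤ c ^ 2 * t := mul_nonneg (by positivity) ht
    rw [dssExtend_of_nonneg v ht, dssExtend_of_nonneg v hct, smul_zero]

/-- **The extension keeps the Type-I decay constant** (scale invariance of `D/(‖x‖+√−t)`). -/
theorem hasTypeIDecay_dssExtend (hc : 1 < c) (ht₀ : t₀ < 0)
    (hsym : ∀ t ≤ t₀, ∀ x, v t x = c • v (c ^ 2 * t) (c • x)) {D : ℝ}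
    (hdec : ∀ t ≤ t₀, ∀ x : E, ‖v t x‖ ≤ D / (‖x‖ + Real.sqrt (-t))) :
    HasTypeIDecay D (dssExtend c t₀ v) := by
  intro t ht x
  have hc0 : 0 < c := zero_lt_one.trans hc
  obtain ⟨k, hk⟩ := exists_pow_mul_le hc ht ht₀
  rw [dssExtend_eq hc ht₀ hsym hk x, norm_smul, Real.norm_of_nonneg (pow_nonneg hc0.le k)]
  have hck : 0 < c ^ k := pow_pos hc0 k
  have hs := hdec (c ^ (2 * k) * t) hk ((c ^ k) • x)
  -- `‖c^k • x‖ + √(−c^{2k} t) = c^k (‖x‖ + √(−t))`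
  have hsq : Real.sqrt (-(c ^ (2 * k) * t)) = c ^ k * Real.sqrt (-t) := by
    have : -(c ^ (2 * k) * t) = (c ^ k) ^ 2 * (-t) := by ring
    rw [this, Real.sqrt_mul (by positivity), Real.sqrt_sq hck.le]
  rw [norm_smul, Real.norm_of_nonneg hck.le, hsq, ← mul_add] at hs
  have hden : 0 < ‖x‖ + Real.sqrt (-t) := by
    have : 0 < Real.sqrt (-t) := Real.sqrt_pos.2 (by linarith)
    positivity
  -- `c^k * (D / (c^k (‖x‖+√−t))) = D / (‖x‖ + √−t)`
  calc c ^ k * ‖v (c ^ (2 * k) * t) ((c ^ k) • x)‖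
      ≤ c ^ k * (D / (c ^ k * (‖x‖ + Real.sqrt (-t)))) := by gcongr
    _ = D / (‖x‖ + Real.sqrt (-t)) := by
      field_simp

end Symmetric

/-- **G4, algebraic half, packaged.**  A field known on `t ≤ t₀ < 0`, symmetric there under one factor `c > 1` and with
Type-I decay `D` there, is the restriction of a GLOBAL `c`-DSS field with decay `D` which on each half-line
`{t : c^{2m} t ≤ t₀}` is the `m`-fold rescaling of the given field (so any window property invariant under the
Navier–Stokes scaling transfers to all negative times). -/
theorem exists_dss_extension {c t₀ : ℝ} (hc : 1 < c) (ht₀ : t₀ < 0) (v : ℝ → E → F)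
    (hsym : ∀ t ≤ t₀, ∀ x, v t x = c • v (c ^ 2 * t) (c • x)) {D : ℝ}
    (hdec : ∀ t ≤ t₀, ∀ x : E, ‖v t x‖ ≤ D / (‖x‖ + Real.sqrt (-t))) :
    ∃ w : ℝ → E → F, IsDiscretelySelfSimilar c w ∧ HasTypeIDecay D w ∧ (∀ t ≤ t₀, ∀ x, w t x = v t x) ∧
      ∀ (m : ℕ) (t : ℝ), c ^ (2 * m) * t ≤ t₀ → ∀ x, w t x = (c ^ m) • v (c ^ (2 * m) * t) ((c ^ m) • x) :=
  ⟨dssExtend c t₀ v, isDiscretelySelfSimilar_dssExtend hc ht₀ hsym, hasTypeIDecay_dssExtend hc ht₀ hsym hdec,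
    fun t ht x => dssExtend_eq_self hc ht₀ hsym ht x, fun m t hm x => dssExtend_eq hc ht₀ hsym hm x⟩

end Summit.NavierStokesRegularity.NavierStokesRegularity.Theorems.ZoomReturnDoorDssExtension
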